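import Literature.NumberTheory.IwasawaTheory.RestrictedTowerLayerSection
import Literature.NumberTheory.IwasawaTheory.ClassicalMuVanishesSemidihedralDescent
import Literature.NumberTheory.NumberFields.KurodaRelationOddPart
import HarnessLib

set_option autoImplicit false

/-!
# Kuroda's class number relation up the cyclotomic tower; growth-fact-free μ-descent (D₄ = N_s(3), SD₁₆ = N_ns(3))

Topic `NumberTheory/IwasawaTheory` (namespace = path).  THEOREM-ONLY file (no definition, no named fact, no `sorry`); literature seat
`bsd-potss-conjA-anchor` g11 (supports stmt-BirchSwinnertonDyer-19386 / 19413; closes nothing).  The planner's R216 lemma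
`classicalMuVanishes_of_kuroda` (g10) took Kuroda's relation AT EVERY LAYER as a displayed hypothesis; with the section
`Gal(L/F) ↪ Gal(L·F_n/F)` of `RestrictedTowerLayerSection.lean` the tree's Kuroda relation for ONE Galois extension ([Lemmermeyer1994] §1,
odd part; `KurodaOddPart.card_torsion_classGroup_biquadratic`, seat g8) gives it for all layers BY NAME, so the descent below needs NO
growth theorem (`iwasawa1959_classNumberPExp_growth` is not a hypothesis anywhere in this file):
* `classNumberPExp_biquadratic_relation` — `κ` a `ℤ_p`-extension of `F` (`p` odd), `L/F` finite Galois with `κ ∘ res` onto, `z, b ∈ Gal(L/F)`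
  commuting involutions: `e_n(κ|_L) + 2·e_n(κ|_{L^{⟨z,b⟩}}) = e_n(κ|_{L^{⟨z⟩}}) + e_n(κ|_{L^{⟨b⟩}}) + e_n(κ|_{L^{⟨zb⟩}})` for all `n`.
* `classicalMuVanishes_restrict_of_biquadratic` — hence `μ = 0` (growth form) over `L^{⟨z⟩}, L^{⟨b⟩}, L^{⟨zb⟩}, L^{⟨z,b⟩}` gives `μ = 0`
  for `L·F_∞/L` (`λ_L = λ_z + λ_b + λ_{zb} − 2λ_{z,b}`); `classicalMuVanishes_of_isCyclotomic_of_biquadratic` — «∀ cyclotomic» form.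
* `classicalMuVanishes_of_isCyclotomic_of_kuroda_rat` — `D₄ = N_s(3)` census form over `ℚ` (`⟨z⟩ ⊇ [G,G]`, `zb = g b g⁻¹`): under
  `ferreroWashington1979_classicalMuVanishes` ALONE, «`μ = 0` for every cyclotomic `ℤ_p`-extension of `L^{⟨b⟩}`» ⇒ the same for `L`.
  For `L = ℚ(E[3])`, `Gal ≅ N_s(3) = ⟨r, s⟩`: `z = −1`, `b = s`, `g = r`, `L^{⟨s⟩} = ℚ(P)`.
* `classicalMuVanishes_of_isCyclotomic_of_semidihedral_kuroda_rat` — `SD₁₆ = N_ns(3)` form from the TWO inputs `L^{⟨s⟩} = ℚ(P)` (octic)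
  and `L^{⟨s, z⟩} = ℚ(x(P))` (quartic) + Ferrero–Washington.  (With the octic input alone use `…_semidihedral_rat`, which pays the
  growth theorem for `ℚ(x(P)) ⊆ ℚ(P)`.)

References: [Lemmermeyer1994] F. Lemmermeyer, *Kuroda's class number formula*, Acta Arith. 66 (1994), §1; [Washington1997] §13.1,
§7.5; [MilneFT2022] Ch. 3; [RaySujatha2021] §1 (1.1); [BiasseEtAl2022] Example 2.5 (the same Klein relation in norm form).
-/

noncomputable section

open scoped NumberField

open Field IntermediateField Literature.NumberTheory.GaloisRepresentations Literature.NumberTheory.EllipticCurves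
  Literature.NumberTheory.EllipticCurves.ZpExtension Literature.NumberTheory.NumberFields

namespace Literature.NumberTheory.IwasawaTheory

/-! ### §0 Counting -/

/-- `#M[p^k] = p^{v_p #M}` for `k ≥ v_p #M` (`M` finite commutative): the `p^k`-torsion is a `p`-group ⊇ a Sylow. [folklore] -/
private theorem card_torsion_eq_pow_factorization' {M : Type*} [CommGroup M] [Finite M] {p : ℕ} [hp : Fact p.Prime]
    {k : ℕ} (hk : (Nat.card M).factorization p ≤ k) :
    Nat.card {m : M // m ^ p ^ k = 1} = p ^ (Nat.card M).factorization p := by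
  classical
  obtain ⟨P⟩ : Nonempty (Sylow p M) := inferInstance
  have hP : Nat.card P = p ^ (Nat.card M).factorization p := P.card_eq_multiplicity
  let T : Subgroup M := (powMonoidHom (p ^ k) : M →* M).ker
  have hT : ∀ m, m ∈ T ↔ m ^ p ^ k = 1 := fun m => Iff.rfl
  have hcardT : Nat.card {m : M // m ^ p ^ k = 1} = Nat.card T :=
    Nat.card_congr (Equiv.subtypeEquivRight fun m => (hT m).symm)
  have hPT : (P : Subgroup M) ≤ T := by
    intro x hx
    rw [hT, ← orderOf_dvd_iff_pow_eq_one]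
    exact (Subgroup.orderOf_dvd_natCard (P : Subgroup M) hx).trans (hP ▸ pow_dvd_pow p hk)
  have hTp : IsPGroup p T := fun x => ⟨k, Subtype.ext ((hT x.1).mp x.2)⟩
  obtain ⟨n, hn⟩ := IsPGroup.iff_card.mp hTp
  have hdvd : p ^ n ∣ Nat.card M := hn ▸ Subgroup.card_subgroup_dvd_card T
  have hn_le : n ≤ (Nat.card M).factorization p :=
    (hp.out.pow_dvd_iff_le_factorization Nat.card_pos.ne').mp hdvd
  have hle : Nat.card P ≤ Nat.card T := Subgroup.card_le_of_le hPT
  rw [hP, hn] at hle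
  have hge : (Nat.card M).factorization p ≤ n := (Nat.pow_le_pow_iff_right hp.out.one_lt).mp hle
  rw [hcardT, hn, le_antisymm hn_le hge]

/-- `#M[p^k] = p^{v_p #M}` for `k ≥ v_p #M`, `padicValNat` form. [folklore] -/
private theorem card_torsion_eq_pow_padicValNat {M : Type*} [CommGroup M] [Finite M] {p : ℕ} [hp : Fact p.Prime]
    {k : ℕ} (hk : padicValNat p (Nat.card M) ≤ k) :
    Nat.card {m : M // m ^ p ^ k = 1} = p ^ padicValNat p (Nat.card M) := by
  rw [← Nat.factorization_def _ hp.out] at hk ⊢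
  exact card_torsion_eq_pow_factorization' hk

variable {F : Type} [Field F] [NumberField F] {p : ℕ} [Fact p.Prime]

/-! ### §1 Kuroda's relation at every layer -/

omit [Fact p.Prime] in
/-- Kuroda's biquadratic relation (odd part) for the Klein four `{1, s z, s b, s (z b)}`, `s : G →* Gal(L'/F)`, written with the
image subgroups `s(⟨z, b⟩)`, `s(⟨z⟩)`, `s(⟨b⟩)`, `s(⟨zb⟩)`. [cite: Lemmermeyer1994, §1 (Kuroda's class number formula, odd part)] -/
private theorem card_torsion_classGroup_biquadratic_map {L' : Type} [Field L'] [NumberField L'] [Algebra F L'] [IsGalois F L']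
    {G : Type*} [Group G] (s : G →* (L' ≃ₐ[F] L')) {z b : G} (hz : z * z = 1) (hb : b * b = 1) (hzb : z * b = b * z)
    {q : ℕ} (hq : Odd q) :
    Nat.card {c : ClassGroup (𝓞 L') // c ^ q = 1} *
        Nat.card {d : ClassGroup (𝓞 ↥(fixedField ((Subgroup.closure {z, b}).map s))) // d ^ q = 1} ^ 2 =
      Nat.card {d : ClassGroup (𝓞 ↥(fixedField ((Subgroup.zpowers z).map s))) // d ^ q = 1} *
        Nat.card {d : ClassGroup (𝓞 ↥(fixedField ((Subgroup.zpowers b).map s))) // d ^ q = 1} *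
        Nat.card {d : ClassGroup (𝓞 ↥(fixedField ((Subgroup.zpowers (z * b)).map s))) // d ^ q = 1} := by
  rw [MonoidHom.map_closure, Set.image_pair, MonoidHom.map_zpowers, MonoidHom.map_zpowers, MonoidHom.map_zpowers, map_mul]
  exact KurodaOddPart.card_torsion_classGroup_biquadratic F L' (s z) (s b) (by rw [← map_mul, hz, map_one])
    (by rw [← map_mul, hb, map_one]) (by rw [← map_mul, ← map_mul, hzb]) hq

/-- **Kuroda's relation up the tower.**  `κ` a `ℤ_p`-extension of the number field `F`, `p` odd, `L/F` finite Galois with `κ ∘ res`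
onto, `z, b ∈ Gal(L/F)` commuting involutions.  Then for every `n`:
`e_n(κ|_L) + 2 e_n(κ|_{L^{⟨z,b⟩}}) = e_n(κ|_{L^{⟨z⟩}}) + e_n(κ|_{L^{⟨b⟩}}) + e_n(κ|_{L^{⟨zb⟩}})` — Kuroda's formula (odd part, [Lemmermeyer1994] §1;
tree `KurodaOddPart.card_torsion_classGroup_biquadratic`) for the Klein four `{1, s z, s b, s(zb)}` of `Gal(L·F_n/F)` (`s` the section of
`RestrictedTowerLayerSection.lean`), whose fixed fields are the `n`-th layers of the four towers, at `q = p^k ≫ 0`.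
[cite: Lemmermeyer1994, §1 (Kuroda's class number formula, odd part)] [cite: Washington1997, §13.1] -/
theorem classNumberPExp_biquadratic_relation (hp2 : p ≠ 2) (κ : ZpExtension F p) (L : Type) [Field L] [NumberField L]
    [Algebra F L] [IsGalois F L] (hL : Function.Surjective (κ.toContinuousMonoidHom.comp (absGaloisRestrict F L)))
    {z b : L ≃ₐ[F] L} (hz : z * z = 1) (hb : b * b = 1) (hzb : z * b = b * z)
    (hZ : Function.Surjective (κ.toContinuousMonoidHom.comp (absGaloisRestrict F ↥(fixedField (Subgroup.zpowers z)))))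
    (hB : Function.Surjective (κ.toContinuousMonoidHom.comp (absGaloisRestrict F ↥(fixedField (Subgroup.zpowers b)))))
    (hZB' : Function.Surjective
      (κ.toContinuousMonoidHom.comp (absGaloisRestrict F ↥(fixedField (Subgroup.zpowers (z * b))))))
    (hC : Function.Surjective
      (κ.toContinuousMonoidHom.comp (absGaloisRestrict F ↥(fixedField (Subgroup.closure {z, b})))))
    (n : ℕ) :
    classNumberPExp (κ.restrict L hL) n + 2 * classNumberPExp (κ.restrict ↥(fixedField (Subgroup.closure {z, b})) hC) n =
      classNumberPExp (κ.restrict ↥(fixedField (Subgroup.zpowers z)) hZ) n +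
        classNumberPExp (κ.restrict ↥(fixedField (Subgroup.zpowers b)) hB) n +
        classNumberPExp (κ.restrict ↥(fixedField (Subgroup.zpowers (z * b))) hZB') n := by
  classical
  haveI : FiniteDimensional F L := Module.Finite.of_restrictScalars_finite ℚ F L
  haveI := isGalois_fieldRange_sup_layer κ L (absEmbedding F L) n
  haveI := finiteDimensional_fieldRange_sup_layer κ L (absEmbedding F L) n
  haveI := numberField_fieldRange_sup_layer κ L (absEmbedding F L) n
  obtain ⟨s, -, -, hcard⟩ := exists_section_fixedField_map_eq κ L hL n
  -- a uniform torsion exponent `q = p^k`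
  obtain ⟨k, hk⟩ : ∃ k, k = classNumberPExp (κ.restrict L hL) n +
      classNumberPExp (κ.restrict ↥(fixedField (Subgroup.closure {z, b})) hC) n +
      classNumberPExp (κ.restrict ↥(fixedField (Subgroup.zpowers z)) hZ) n +
      classNumberPExp (κ.restrict ↥(fixedField (Subgroup.zpowers b)) hB) n +
      classNumberPExp (κ.restrict ↥(fixedField (Subgroup.zpowers (z * b))) hZB') n := ⟨_, rfl⟩
  have hodd : Odd (p ^ k) := Odd.pow ((Fact.out : p.Prime).odd_of_ne_two hp2)
  -- Kuroda for the Klein four `{1, s z, s b, s (z b)}` of `Gal(L_n/F)` at `q = p^k`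
  have K := card_torsion_classGroup_biquadratic_map s hz hb hzb hodd
  -- convert `q`-torsion cardinalities into `p ^ e_n`
  have torsL : ∀ {M : Type} [CommGroup M] [Finite M],
      Nat.card M = Nat.card (ClassGroup (𝓞 ↥((κ.restrict L hL).layer n))) →
      Nat.card {m : M // m ^ p ^ k = 1} = p ^ classNumberPExp (κ.restrict L hL) n := by
    intro M _ _ hM
    have h := card_torsion_eq_pow_padicValNat (p := p) (k := k) (M := M) (by rw [hM, ← classNumberPExp_def]; omega)
    rwa [hM, ← classNumberPExp_def] at h
  have tors : ∀ (H : Subgroup (L ≃ₐ[F] L))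
      (hH : Function.Surjective (κ.toContinuousMonoidHom.comp (absGaloisRestrict F ↥(fixedField H)))),
      classNumberPExp (κ.restrict ↥(fixedField H) hH) n ≤ k →
      Nat.card {d : ClassGroup (𝓞 ↥(fixedField (H.map s))) // d ^ p ^ k = 1} =
        p ^ classNumberPExp (κ.restrict ↥(fixedField H) hH) n := by
    intro H hH hle
    have h := card_torsion_eq_pow_padicValNat (p := p) (k := k) (M := ClassGroup (𝓞 ↥(fixedField (H.map s))))
      (by rw [hcard H hH, ← classNumberPExp_def]; exact hle)
    rwa [hcard H hH, ← classNumberPExp_def] at h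
  have e0 := (natCard_classGroup_layer_restrict_eq κ L hL (absEmbedding F L) n).symm
  rw [torsL e0, tors _ hC (by omega), tors _ hZ (by omega), tors _ hB (by omega), tors _ hZB' (by omega), ← pow_mul,
    ← pow_add, ← pow_add, ← pow_add] at K
  have hinj := Nat.pow_right_injective (Fact.out : p.Prime).two_le K
  omega

/-! ### §2 Growth-fact-free μ-descent through a Klein four-group -/

/-- **μ-descent through a Klein four-group, FACT-FREE (Kuroda form).**  With `z, b` as above: if the restricted towers over
`L^{⟨z⟩}`, `L^{⟨b⟩}`, `L^{⟨zb⟩}` and `L^{⟨z,b⟩}` have `μ = 0` in growth form, so does `L·F_∞/L`, with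
`e_n(L) = (λ_z + λ_b + λ_{zb} − 2λ_{z,b}) n + const` for `n ≫ 0` — no growth theorem is used (`classicalMuVanishes_of_eventually_intLinear`).
[cite: Lemmermeyer1994, §1 (Kuroda's class number formula, odd part)] [cite: RaySujatha2021, §1 eq. (1.1)] -/
theorem classicalMuVanishes_restrict_of_biquadratic (hp2 : p ≠ 2) (κ : ZpExtension F p) (L : Type) [Field L] [NumberField L]
    [Algebra F L] [IsGalois F L] (hL : Function.Surjective (κ.toContinuousMonoidHom.comp (absGaloisRestrict F L)))
    {z b : L ≃ₐ[F] L} (hz : z * z = 1) (hb : b * b = 1) (hzb : z * b = b * z)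
    (hZ : Function.Surjective (κ.toContinuousMonoidHom.comp (absGaloisRestrict F ↥(fixedField (Subgroup.zpowers z)))))
    (hB : Function.Surjective (κ.toContinuousMonoidHom.comp (absGaloisRestrict F ↥(fixedField (Subgroup.zpowers b)))))
    (hZB' : Function.Surjective
      (κ.toContinuousMonoidHom.comp (absGaloisRestrict F ↥(fixedField (Subgroup.zpowers (z * b))))))
    (hC : Function.Surjective
      (κ.toContinuousMonoidHom.comp (absGaloisRestrict F ↥(fixedField (Subgroup.closure {z, b})))))
    (hμZ : ClassicalMuVanishes (κ.restrict ↥(fixedField (Subgroup.zpowers z)) hZ))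
    (hμB : ClassicalMuVanishes (κ.restrict ↥(fixedField (Subgroup.zpowers b)) hB))
    (hμZB : ClassicalMuVanishes (κ.restrict ↥(fixedField (Subgroup.zpowers (z * b))) hZB'))
    (hμC : ClassicalMuVanishes (κ.restrict ↥(fixedField (Subgroup.closure {z, b})) hC)) :
    ClassicalMuVanishes (κ.restrict L hL) := by
  obtain ⟨lZ, νZ, nZ, hZ'⟩ := hμZ
  obtain ⟨lB, νB, nB, hB'⟩ := hμB
  obtain ⟨lZB, νZB, nZB, hZB''⟩ := hμZB
  obtain ⟨lC, νC, nC, hC'⟩ := hμC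
  refine classicalMuVanishes_of_eventually_intLinear (κ.restrict L hL) (l := (lZ : ℤ) + lB + lZB - 2 * lC)
    (ν := νZ + νB + νZB - 2 * νC) (n₀ := nZ + nB + nZB + nC) fun n hn => ?_
  have hrel := classNumberPExp_biquadratic_relation hp2 κ L hL hz hb hzb hZ hB hZB' hC n
  have h1 := hZ' n (by omega)
  have h2 := hB' n (by omega)
  have h3 := hZB'' n (by omega)
  have h4 := hC' n (by omega)
  have hrel' := congrArg (Nat.cast (R := ℤ)) hrel
  push_cast at hrel'
  linear_combination hrel' + h1 + h2 + h3 - 2 * h4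

/-! ### §3 «∀ cyclotomic» forms and the census forms over `ℚ`, without the growth fact -/

omit [NumberField F] [Fact p.Prime] in
/-- `p ∤ [E : F]` for an intermediate field `E` of `L/F` when `p ∤ [L : F]`. [folklore] -/
private theorem not_dvd_finrank_intermediateField' {L : Type} [Field L] [Algebra F L] [FiniteDimensional F L]
    (hp : ¬ p ∣ Module.finrank F L) (E : IntermediateField F L) : ¬ p ∣ Module.finrank F ↥E := fun h =>
  hp (h.trans (Dvd.intro _ (Module.finrank_mul_finrank F ↥E L)))

omit [NumberField F] [Fact p.Prime] in
/-- For `N ⊴ Gal(L/F)`, `N ≤ H`, `M = L^N`: the fixed field in `M` of the image `H̄` of `H` in `Gal(M/F)` is `L^H`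
(`InfiniteGalois.restrict_fixedField`), whence `M^{H̄} ≃ₐ[F] L^H`. [cite: MilneFT2022, Ch. 3 (fundamental theorem: `Gal(M/F) = G/N`)] -/
private theorem nonempty_algEquiv_fixedField_of_map_restrictNormalHom' {L : Type} [Field L] [Algebra F L]
    [FiniteDimensional F L] [IsGalois F L] (N H : Subgroup (L ≃ₐ[F] L)) [N.Normal] (hNH : N ≤ H)
    (H' : Subgroup (↥(fixedField N) ≃ₐ[F] ↥(fixedField N)))
    (hH' : H.map (AlgEquiv.restrictNormalHom ↥(fixedField N)) = H') :
    Nonempty (↥(fixedField H') ≃ₐ[F] ↥(fixedField H)) := by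
  have h1 := InfiniteGalois.restrict_fixedField H (fixedField N)
  rw [hH'] at h1
  have h2 : IntermediateField.lift (fixedField H') = fixedField H := by
    rw [← h1]; exact inf_eq_left.mpr (IntermediateField.fixedField_le hNH)
  exact ⟨(IntermediateField.liftAlgEquiv (fixedField H')).trans (IntermediateField.equivOfEq h2)⟩

/-- **«∀ cyclotomic» form of the fact-free Klein descent.**  `L/F` finite Galois, `p` odd, `p ∤ [L : F]`, `z, b ∈ Gal(L/F)` commuting
involutions: «`μ = 0` for every cyclotomic `ℤ_p`-extension» of each of `L^{⟨z⟩}`, `L^{⟨b⟩}`, `L^{⟨zb⟩}`, `L^{⟨z,b⟩}` gives the same for `L`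
— by Kuroda's relation at every layer; no growth theorem. [cite: Lemmermeyer1994, §1 (odd part)] [cite: Washington1997, §13.1] -/
theorem classicalMuVanishes_of_isCyclotomic_of_biquadratic (hp2 : p ≠ 2) (L : Type) [Field L] [NumberField L] [Algebra F L]
    [IsGalois F L] (hp : ¬ p ∣ Module.finrank F L) {z b : L ≃ₐ[F] L} (hz : z * z = 1) (hb : b * b = 1) (hzb : z * b = b * z)
    (hμZ : ∀ κE : ZpExtension ↥(fixedField (Subgroup.zpowers z)) p, κE.IsCyclotomic → ClassicalMuVanishes κE)
    (hμB : ∀ κE : ZpExtension ↥(fixedField (Subgroup.zpowers b)) p, κE.IsCyclotomic → ClassicalMuVanishes κE)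
    (hμZB : ∀ κE : ZpExtension ↥(fixedField (Subgroup.zpowers (z * b))) p, κE.IsCyclotomic → ClassicalMuVanishes κE)
    (hμC : ∀ κE : ZpExtension ↥(fixedField (Subgroup.closure {z, b})) p, κE.IsCyclotomic → ClassicalMuVanishes κE)
    (κL : ZpExtension L p) (hκL : κL.IsCyclotomic) : ClassicalMuVanishes κL := by
  obtain ⟨κ, hκ⟩ := exists_cyclotomicZpExtension_holds F p
  haveI : FiniteDimensional F L := Module.Finite.of_restrictScalars_finite ℚ F L
  have hs : ∀ E : IntermediateField F L, Function.Surjective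
      (κ.toContinuousMonoidHom.comp (absGaloisRestrict F ↥E)) := fun E =>
    surjective_comp_absGaloisRestrict_of_not_dvd_finrank κ _ (not_dvd_finrank_intermediateField' hp E)
  have hL := surjective_comp_absGaloisRestrict_of_not_dvd_finrank κ L hp
  have h1 : ClassicalMuVanishes (κ.restrict L hL) :=
    classicalMuVanishes_restrict_of_biquadratic hp2 κ L hL hz hb hzb (hs _) (hs _) (hs _) (hs _)
      (hμZ _ (isCyclotomic_restrict κ hκ _ (hs _))) (hμB _ (isCyclotomic_restrict κ hκ _ (hs _)))
      (hμZB _ (isCyclotomic_restrict κ hκ _ (hs _))) (hμC _ (isCyclotomic_restrict κ hκ _ (hs _)))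
  exact (classicalMuVanishes_iff_of_isCyclotomic _ _ (isCyclotomic_restrict κ hκ L hL) hκL).mp h1

/-- **`D₄ = N_s(3)` census form, growth-fact-free: `μ(L) = 0 ⟸ μ(L^{⟨b⟩}) = 0` modulo Ferrero–Washington alone.**  `L/ℚ` finite
Galois, `p` odd, `p ∤ [L:ℚ]`, `z, b ∈ Gal(L/ℚ)` commuting involutions with `⟨z⟩ ⊇ [G, G]` (so `L^{⟨z⟩}`, `L^{⟨z,b⟩}` are abelian over `ℚ`)
and `z b = g b g⁻¹` for some `g` (so `L^{⟨zb⟩} ≅ L^{⟨b⟩}`).  If `μ = 0` holds for every cyclotomic `ℤ_p`-extension of `L^{⟨b⟩}`, then —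
under `ferreroWashington1979_classicalMuVanishes` — for every cyclotomic `ℤ_p`-extension of `L` (compare `…_of_klein_four_rat`, which also
needs Iwasawa's growth theorem).  For `L = ℚ(E[3])`, `Gal ≅ N_s(3) = ⟨r, s⟩ ≅ D₄`: `z = −1`, `b = s` (fixing `P`), `g = r`; `L^{⟨s⟩} = ℚ(P)`.
[cite: Lemmermeyer1994, §1 (Kuroda's class number formula, odd part)] [cite: Washington1997, §13.1, §7.5] -/
theorem classicalMuVanishes_of_isCyclotomic_of_kuroda_rat (hFW : ferreroWashington1979_classicalMuVanishes) (hp2 : p ≠ 2)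
    (L : Type) [Field L] [NumberField L] [IsGalois ℚ L] (hp : ¬ p ∣ Module.finrank ℚ L)
    {z b : L ≃ₐ[ℚ] L} (hz : z * z = 1) (hb : b * b = 1) (hzb : z * b = b * z)
    (hconj : ∃ g : L ≃ₐ[ℚ] L, g * b * g⁻¹ = z * b)
    (hcomm : ∀ a c : L ≃ₐ[ℚ] L, a * c * a⁻¹ * c⁻¹ ∈ Subgroup.zpowers z)
    (hμb : ∀ κE : ZpExtension ↥(fixedField (Subgroup.zpowers b)) p, κE.IsCyclotomic → ClassicalMuVanishes κE)
    (κL : ZpExtension L p) (hκL : κL.IsCyclotomic) : ClassicalMuVanishes κL := by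
  -- `⟨z⟩ ⊇ [G,G]` and `⟨z, b⟩ ⊇ [G,G]`: normal with abelian quotients
  haveI hzN : (Subgroup.zpowers z).Normal := by
    refine ⟨fun h hh a => ?_⟩
    have h2 : a * h * a⁻¹ = (a * h * a⁻¹ * h⁻¹) * h := by group
    rw [h2]
    exact Subgroup.mul_mem _ (hcomm a h) hh
  have hzC : Subgroup.zpowers z ≤ Subgroup.closure {z, b} := by
    rw [Subgroup.zpowers_le]
    exact Subgroup.subset_closure (Set.mem_insert z {b})
  haveI hCN : (Subgroup.closure ({z, b} : Set (L ≃ₐ[ℚ] L))).Normal := by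
    refine ⟨fun h hh a => ?_⟩
    have h2 : a * h * a⁻¹ = (a * h * a⁻¹ * h⁻¹) * h := by group
    rw [h2]
    exact Subgroup.mul_mem _ (hzC (hcomm a h)) hh
  haveI : IsAbelianGalois ℚ ↥(fixedField (Subgroup.zpowers z)) :=
    isAbelianGalois_fixedField_of_commutator_mem (Subgroup.zpowers z) hcomm
  haveI : IsAbelianGalois ℚ ↥(fixedField (Subgroup.closure ({z, b} : Set (L ≃ₐ[ℚ] L)))) :=
    isAbelianGalois_fixedField_of_commutator_mem _ fun a c => hzC (hcomm a c)
  -- `L^{⟨zb⟩} ≅ L^{⟨b⟩}`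
  obtain ⟨g, hg⟩ := hconj
  have hmap : (Subgroup.zpowers b).map (MulAut.conj g).toMonoidHom = Subgroup.zpowers (z * b) := by
    rw [MonoidHom.map_zpowers]
    exact congrArg Subgroup.zpowers hg
  obtain ⟨φ⟩ := nonempty_algEquiv_fixedField_conj (F := ℚ) (Subgroup.zpowers b) g
  have hμzb : ∀ κE : ZpExtension ↥(fixedField (Subgroup.zpowers (z * b))) p, κE.IsCyclotomic → ClassicalMuVanishes κE :=
    forall_classicalMuVanishes_of_algEquiv (φ.trans (IntermediateField.equivOfEq (congrArg fixedField hmap)))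
      (not_dvd_finrank_intermediateField' hp _) hμb
  exact classicalMuVanishes_of_isCyclotomic_of_biquadratic hp2 L hp hz hb hzb (fun κE hκE => hFW _ p κE hκE) hμb hμzb
    (fun κE hκE => hFW _ p κE hκE) κL hκL

/-- **`SD₁₆ = N_ns(3)` census form, growth-fact-free: `μ(L) = 0 ⟸ μ(L^{⟨s⟩}) = 0 ∧ μ(L^{⟨s,z⟩}) = 0` modulo Ferrero–Washington.**
`L/ℚ` finite Galois, `p` odd, `p ∤ [L : ℚ]`; `w, s ∈ Gal(L/ℚ)` with `z = w²` central, `z² = 1`, `s² = 1`, `s w s⁻¹ = w⁻¹`, `g s g⁻¹ = w³ s`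
for some `g`, `⟨w⟩ ⊇ [G, G]`.  If `μ = 0` holds for every cyclotomic `ℤ_p`-extension of `L^{⟨s⟩}` AND of `L^{⟨s⟩ ⊔ ⟨z⟩}`, then for every
cyclotomic `ℤ_p`-extension of `L`.  Road: Kuroda for `{1, z, s, zs}` in `G` (supports `M = L^{⟨z⟩}`, `L^{⟨s⟩} ≅ L^{⟨zs⟩}`, `L^{⟨z,s⟩}`) and
for `{1, w̄, s̄, w̄s̄}` in `Gal(M/ℚ) = G/⟨z⟩` (supports `L^{⟨w⟩}`, `L^{⟨w,s⟩}` abelian; `M^{⟨s̄⟩} ≅ L^{⟨s,z⟩} ≅ M^{⟨w̄ s̄⟩}`).  For `L = ℚ(E[3])`,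
`Gal ≅ N_ns(3) = ⟨r, s⟩ ≅ SD₁₆`: `w = r²`, `g = r`, `L^{⟨s⟩} = ℚ(P)` (degree `8`), `L^{⟨s,−1⟩} = ℚ(x(P))` (degree `4`).
[cite: Lemmermeyer1994, §1 (Kuroda's class number formula, odd part)] [cite: Washington1997, §13.1, §7.5] [cite: MilneFT2022, Ch. 3] -/
theorem classicalMuVanishes_of_isCyclotomic_of_semidihedral_kuroda_rat (hFW : ferreroWashington1979_classicalMuVanishes)
    (hp2 : p ≠ 2) (L : Type) [Field L] [NumberField L] [IsGalois ℚ L] (hp : ¬ p ∣ Module.finrank ℚ L)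
    {w s : L ≃ₐ[ℚ] L} (hzc : ∀ g : L ≃ₐ[ℚ] L, g * (w * w) = (w * w) * g) (hz4 : (w * w) * (w * w) = 1)
    (hs : s * s = 1) (hdih : s * w * s⁻¹ = w⁻¹) (hconj : ∃ g : L ≃ₐ[ℚ] L, g * s * g⁻¹ = w * w * w * s)
    (hcomm : ∀ a b : L ≃ₐ[ℚ] L, a * b * a⁻¹ * b⁻¹ ∈ Subgroup.zpowers w)
    (hμs : ∀ κE : ZpExtension ↥(fixedField (Subgroup.zpowers s)) p, κE.IsCyclotomic → ClassicalMuVanishes κE)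
    (hμsz : ∀ κE : ZpExtension ↥(fixedField (Subgroup.zpowers s ⊔ Subgroup.zpowers (w * w))) p,
      κE.IsCyclotomic → ClassicalMuVanishes κE)
    (κL : ZpExtension L p) (hκL : κL.IsCyclotomic) : ClassicalMuVanishes κL := by
  set z : L ≃ₐ[ℚ] L := w * w with hz
  -- group-theoretic bookkeeping in `G = Gal(L/ℚ)`
  have hwinv : w⁻¹ = w * z := inv_eq_of_mul_eq_one_right (by rw [← mul_assoc, ← hz]; exact hz4)
  have hsw : s * w = w * z * s := by
    have h1 : s * w = w⁻¹ * s := by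
      calc s * w = s * w * s⁻¹ * s := by group
        _ = w⁻¹ * s := by rw [hdih]
    rw [h1, hwinv]
  have hconj₁ : w * s * w⁻¹ = z * s := by
    have h1 : s * w⁻¹ * s⁻¹ = w := by
      have := congrArg (·⁻¹) hdih
      simpa only [mul_inv_rev, inv_inv, ← mul_assoc] using this
    calc w * s * w⁻¹ = w * (s * w⁻¹ * s⁻¹) * s := by group
      _ = z * s := by rw [h1, ← hz]
  have hzs : z * s = s * z := (hzc s).symm
  -- normal subgroups `⟨z⟩` (central), `⟨w⟩ ⊇ [G,G]`
  haveI hzN : (Subgroup.zpowers z).Normal := by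
    refine ⟨fun h hh a => ?_⟩
    obtain ⟨k, rfl⟩ := Subgroup.mem_zpowers_iff.mp hh
    rw [(Commute.zpow_right (hzc a) k).eq, mul_inv_cancel_right]
    exact hh
  haveI hwN : (Subgroup.zpowers w).Normal := by
    refine ⟨fun h hh a => ?_⟩
    have h2 : a * h * a⁻¹ = (a * h * a⁻¹ * h⁻¹) * h := by group
    rw [h2]
    exact Subgroup.mul_mem _ (hcomm a h) hh
  -- the quotient `Gal(M/ℚ)`, `M = L^{⟨z⟩}`
  set M : IntermediateField ℚ L := fixedField (Subgroup.zpowers z) with hM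
  haveI : IsGalois ℚ ↥M := IsGalois.of_fixedField_normal_subgroup (Subgroup.zpowers z)
  have hpM : ¬ p ∣ Module.finrank ℚ ↥M := not_dvd_finrank_intermediateField' hp M
  set π : (L ≃ₐ[ℚ] L) →* (↥M ≃ₐ[ℚ] ↥M) := AlgEquiv.restrictNormalHom ↥M with hπ
  have hker : π.ker = Subgroup.zpowers z := by
    have h1 := IntermediateField.restrictNormalHom_ker (K := ℚ) (L := L) (fixedField (Subgroup.zpowers z))
    rw [IntermediateField.fixingSubgroup_fixedField] at h1
    exact h1
  have hπz : π z = 1 := by rw [← MonoidHom.mem_ker, hker]; exact Subgroup.mem_zpowers z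
  -- `w̄, s̄` are commuting involutions with `w̄ s̄` conjugate to `s̄`
  have hu : π w * π w = 1 := by rw [← map_mul, ← hz, hπz]
  have hv : π s * π s = 1 := by rw [← map_mul, hs, map_one]
  have huv : π w * π s = π s * π w := by
    rw [← map_mul, ← map_mul, hsw, map_mul, map_mul, map_mul, hπz, mul_one]
  have hconj₂ : ∃ g : ↥M ≃ₐ[ℚ] ↥M, g * π s * g⁻¹ = π w * π s := by
    obtain ⟨g, hg⟩ := hconj
    refine ⟨π g, ?_⟩
    rw [← map_inv, ← map_mul, ← map_mul, hg, map_mul, map_mul, hπz, one_mul]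
  -- commutators of `Gal(M/ℚ)` lie in `⟨w̄⟩ ≤ ⟨w̄, s̄⟩`; so `M^{⟨w̄⟩}`, `M^{⟨w̄,s̄⟩}` are abelian
  have hπw : (Subgroup.zpowers w).map π = Subgroup.zpowers (π w) := MonoidHom.map_zpowers π w
  haveI hπwN : (Subgroup.zpowers (π w)).Normal := by
    rw [← hπw]
    exact Subgroup.Normal.map hwN π (AlgEquiv.restrictNormalHom_surjective L)
  have hcomm' : ∀ a b : ↥M ≃ₐ[ℚ] ↥M, a * b * a⁻¹ * b⁻¹ ∈ Subgroup.zpowers (π w) := by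
    intro a b
    obtain ⟨a, rfl⟩ := AlgEquiv.restrictNormalHom_surjective L a
    obtain ⟨b, rfl⟩ := AlgEquiv.restrictNormalHom_surjective L b
    have h1 : π (a * b * a⁻¹ * b⁻¹) ∈ (Subgroup.zpowers w).map π := Subgroup.mem_map_of_mem π (hcomm a b)
    rw [hπw, map_mul, map_mul, map_mul, map_inv, map_inv] at h1
    exact h1
  haveI : IsAbelianGalois ℚ ↥(fixedField (Subgroup.zpowers (π w))) :=
    isAbelianGalois_fixedField_of_commutator_mem (Subgroup.zpowers (π w)) hcomm'
  have hwC : Subgroup.zpowers (π w) ≤ Subgroup.closure {π w, π s} := by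
    rw [Subgroup.zpowers_le]
    exact Subgroup.subset_closure (Set.mem_insert (π w) {π s})
  haveI hCN : (Subgroup.closure ({π w, π s} : Set (↥M ≃ₐ[ℚ] ↥M))).Normal := by
    refine ⟨fun h hh a => ?_⟩
    have h2 : a * h * a⁻¹ = (a * h * a⁻¹ * h⁻¹) * h := by group
    rw [h2]
    exact Subgroup.mul_mem _ (hwC (hcomm' a h)) hh
  haveI : IsAbelianGalois ℚ ↥(fixedField (Subgroup.closure ({π w, π s} : Set (↥M ≃ₐ[ℚ] ↥M)))) :=
    isAbelianGalois_fixedField_of_commutator_mem _ fun a c => hwC (hcomm' a c)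
  -- `M^{⟨s̄⟩} ≅ L^{⟨s⟩ ⊔ ⟨z⟩}` and `M^{⟨w̄ s̄⟩} ≅ M^{⟨s̄⟩}`
  set Hs : Subgroup (L ≃ₐ[ℚ] L) := Subgroup.zpowers s ⊔ Subgroup.zpowers z with hHs
  have hπs : Hs.map π = Subgroup.zpowers (π s) := by
    rw [hHs, Subgroup.map_sup, MonoidHom.map_zpowers, MonoidHom.map_zpowers, hπz, Subgroup.zpowers_one_eq_bot,
      sup_bot_eq]
  obtain ⟨eS⟩ := nonempty_algEquiv_fixedField_of_map_restrictNormalHom' (F := ℚ) (Subgroup.zpowers z) Hs le_sup_right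
    (Subgroup.zpowers (π s)) hπs
  have hμv : ∀ κE : ZpExtension ↥(fixedField (Subgroup.zpowers (π s))) p, κE.IsCyclotomic → ClassicalMuVanishes κE :=
    forall_classicalMuVanishes_of_algEquiv eS.symm (not_dvd_finrank_intermediateField' hp _) hμsz
  obtain ⟨g₂, hg₂⟩ := hconj₂
  have hmap₂ : (Subgroup.zpowers (π s)).map (MulAut.conj g₂).toMonoidHom = Subgroup.zpowers (π w * π s) := by
    rw [MonoidHom.map_zpowers]
    exact congrArg Subgroup.zpowers hg₂
  obtain ⟨φ₂⟩ := nonempty_algEquiv_fixedField_conj (F := ℚ) (Subgroup.zpowers (π s)) g₂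
  have hμuv : ∀ κE : ZpExtension ↥(fixedField (Subgroup.zpowers (π w * π s))) p,
      κE.IsCyclotomic → ClassicalMuVanishes κE :=
    forall_classicalMuVanishes_of_algEquiv (φ₂.trans (IntermediateField.equivOfEq (congrArg fixedField hmap₂)))
      (not_dvd_finrank_intermediateField' hpM _) hμv
  -- Step 2: `μ(M) = 0` by Kuroda for `{1, w̄, s̄, w̄ s̄}` in `Gal(M/ℚ)`
  have hμM : ∀ κM : ZpExtension ↥M p, κM.IsCyclotomic → ClassicalMuVanishes κM :=
    classicalMuVanishes_of_isCyclotomic_of_biquadratic hp2 ↥M hpM hu hv huv (fun κE hκE => hFW _ p κE hκE) hμv hμuv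
      (fun κE hκE => hFW _ p κE hκE)
  -- Step 1: `μ(L) = 0` by Kuroda for `{1, z, s, z s}` in `G`: `L^{⟨zs⟩} ≅ L^{⟨s⟩}`, `L^{⟨z,s⟩} = L^{⟨s⟩ ⊔ ⟨z⟩}`
  have hmap₁ : (Subgroup.zpowers s).map (MulAut.conj w).toMonoidHom = Subgroup.zpowers (z * s) := by
    rw [MonoidHom.map_zpowers]
    exact congrArg Subgroup.zpowers hconj₁
  obtain ⟨φ₁⟩ := nonempty_algEquiv_fixedField_conj (F := ℚ) (Subgroup.zpowers s) w
  have hμzs : ∀ κE : ZpExtension ↥(fixedField (Subgroup.zpowers (z * s))) p, κE.IsCyclotomic → ClassicalMuVanishes κE :=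
    forall_classicalMuVanishes_of_algEquiv (φ₁.trans (IntermediateField.equivOfEq (congrArg fixedField hmap₁)))
      (not_dvd_finrank_intermediateField' hp _) hμs
  have hC : Subgroup.closure {z, s} = Hs := by
    rw [hHs, Set.insert_eq, Subgroup.closure_union, ← Subgroup.zpowers_eq_closure, ← Subgroup.zpowers_eq_closure, sup_comm]
  have hμC : ∀ κE : ZpExtension ↥(fixedField (Subgroup.closure {z, s})) p, κE.IsCyclotomic → ClassicalMuVanishes κE :=
    forall_classicalMuVanishes_of_algEquiv (IntermediateField.equivOfEq (congrArg fixedField hC.symm))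
      (not_dvd_finrank_intermediateField' hp _) hμsz
  exact classicalMuVanishes_of_isCyclotomic_of_biquadratic hp2 L hp hz4 hs hzs hμM hμs hμzs hμC κL hκL

end Literature.NumberTheory.IwasawaTheory

end
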